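import Literature.Analysis.Fourier.HilbertTransformCircleCap
import HarnessLib

/-!
# The Schochet corner of the viscous gCLM/OSW profile MODEL, PERIODISED: on the torus the corner pole is an exact
# DECAY direction of the viscous Constantin–Lax–Majda flow (coefficientwise kernel identity + the genuine periodic Hilbert transform)

HONEST FRAMING (cell ns-blowup GROUP B «PROFILE SEARCH», zone Z3, case Z3-U of `HOME/profile/z3/SHEET.md` §14; human rulings
D-0035/D-0074): **1-D MODEL (viscous Constantin–Lax–Majda equation `ω_t = ω Hω + ν ω_xx` on the torus `𝕋 = ℝ/2πℤ`, i.e. the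
`a = 0` member of the viscous gCLM/OSW family); not Euler, not Navier–Stokes; «violates: none — MODEL».** Nothing here is a
statement about Navier–Stokes.

OBJECT. On the line the «Schochet corner» of the NS-type line of the frozen-`ε` profile sheet is the dilation family of exact double
poles `Ω_ℓ(η) = −24εℓ·η/(η² + ℓ²)²` solving `(HΩ)Ω + εΩ″ = 0` — every width `ℓ` is an exact STEADY state of the viscous CLM
(`SheetNSLineSchochetCorner.corner_solves`, `…schochetCorner_solves_nsLine_equation`). In the complex form `z := Hω − iω`
(boundary value of a function analytic in the upper half-plane; `H(ωHω) = ½((Hω)² − ω²)` turns the viscous CLM into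
`z_t = ½ z² + ν z_xx`) that pole is `z = −12ν/(x − x₀)²`, `Im x₀ < 0`. Its PERIODISATION is
`z_P(x) = −12ν Σ_n (x − x₀ − 2πn)⁻² = −3ν csc²((x − x₀)/2) = 12ν Σ_{k ≥ 1} k e^{ik(x − x₀)}` (since `csc²(w/2) = −4 Σ_{k≥1} k e^{ikw}`
for `Im w > 0`), i.e. with `x₀ = −iλ`, `r = e^{−λ} ∈ (0, 1)`: `ω_P(x) = −12ν Σ_{k≥1} k r^k sin(kx)`, `Hω_P(x) = 12ν Σ_{k≥1} k r^k cos(kx)`.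

THE FACTS.
* `sum_range_mul_sub` — `6·Σ_{j=0}^{k} j(k − j) = k³ − k` (the convolution sum of the coefficient sequence `k ↦ k`).
* `torusCorner_coeff_identity` — **the `k`-th Fourier coefficient of `ν z_P″ + ½ z_P²` equals `−ν` times that of `z_P`**:
  `½ Σ_{i+j=k} (12ν i r^i)(12ν j r^j) − ν k² (12ν k r^k) = −ν (12ν k r^k)` for every `k`, every `ν`, every `r` — so on the torus the
  periodised corner satisfies `ν z_P″ + ½ z_P² = −ν z_P` EXACTLY (the profile-refuter re-derived the same by `csc`-calculus: with
  `z = A csc² s`, `s = (x − x₀)/2`: `νz″ + ½z² = (½A² + 3νA/2)csc⁴s − νA csc²s = −νz` iff `A = −3ν`): unlike on `ℝ`, the corner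
  structure is NOT steady on `𝕋` — at frozen width it DECAYS at the rate `ν` of the first Fourier mode. (Function-level reading of
  the identity = pen; the kernel content is the coefficient identity, which is the whole computation.)
* `torusCorner_hilbert` — the genuine periodic Hilbert transform (p.v. `cot` kernel, `Literature.Analysis.Fourier.hilbertTransformCircle`)
  of `ω_P = sinEval s`, `s_k = −12ν k r^k` (`0 ≤ r < 1`), IS `cosEval (hilbS2C s)`, i.e. `x ↦ Σ_{k≥1} 12ν k r^k cos(kx)` — the
  coefficient sequences above are those of a genuine `(ω, Hω)` pair on `𝕋` (via `hilbertTransformCircle_sinEval`, first moment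
  `Σ k²r^k < ∞`).
USE (SHEET §14, case Z3-U, the class (D) observation it explains): from generic smooth data at `a = 0` the constant-`ν` torus
solution forms the Schochet SHAPE (the case's T-free fingerprints converge to the double-pole values) while its amplitude rises and
then FALLS — no finite-time collapse from that datum on `𝕋`, whereas on `ℝ` Schochet's solution blows up from arbitrarily small
data [Schochet 1986; Ambrose–Lushnikov–Siegel–Silantyev 2024 §5.1.1/§7.3.1] (numbers: SHEET §14.3, not restated here);
Silantyev–Lushnikov–Siegel 2025 (arXiv:2411.01891, p. 25) record that the `a = 0`, `σ = 2` periodic problem has no closed-form pole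
solution. WHAT IS NOT HERE: no statement about the time-dependent torus solution (the family `{c·csc²}` is not invariant under the
flow), no non-existence theorem for periodic steady states (pen remark of SHEET §14.6 (ii) via the equianharmonic `℘`, not
kernel-checked), no dynamics. No `def`, no `Prop` hypotheses. bears_on: LADDER-NS N5 / zone Z3 (case Z3-U) → N1 linear core.
-/

namespace Summit.NavierStokesRegularity.OSWSelfSimilar
namespace SheetNSLineSchochetCornerTorus

open Finset
open Literature.Analysis.Fourier Literature.Analysis.ValidatedNumerics.WeightedEllOne

/-- `Σ_{j<n} j = n(n−1)/2` over `ℝ`. [folklore; the same statement exists in another summit tree (BalabanUV), not importable here] -/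
private theorem sum_range_id_real (n : ℕ) : ∑ j ∈ range n, (j : ℝ) = (n : ℝ) * (n - 1) / 2 := by
  induction n with
  | zero => simp
  | succ n ih =>
    rw [sum_range_succ, ih]
    push_cast
    ring

/-- `Σ_{j<n} j² = n(n−1)(2n−1)/6` over `ℝ`. [folklore; idem] -/
private theorem sum_range_sq_real (n : ℕ) : ∑ j ∈ range n, (j : ℝ) ^ 2 = (n : ℝ) * (n - 1) * (2 * n - 1) / 6 := by
  induction n with
  | zero => simp
  | succ n ih =>
    rw [sum_range_succ, ih]
    push_cast
    ring

/-- The convolution sum of the sequence `k ↦ k`: `6·Σ_{j=0}^{k} j(k−j) = k³ − k`. [folklore] -/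
theorem sum_range_mul_sub (k : ℕ) :
    6 * ∑ j ∈ range (k + 1), (j : ℝ) * ((k : ℝ) - j) = (k : ℝ) ^ 3 - k := by
  have h1 := sum_range_id_real (k + 1)
  have h2 := sum_range_sq_real (k + 1)
  have hsplit : ∑ j ∈ range (k + 1), (j : ℝ) * ((k : ℝ) - j)
      = (k : ℝ) * ∑ j ∈ range (k + 1), (j : ℝ) - ∑ j ∈ range (k + 1), (j : ℝ) ^ 2 := by
    rw [mul_sum, ← sum_sub_distrib]
    refine sum_congr rfl fun j _ => ?_
    ring
  rw [hsplit, h1, h2]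
  push_cast
  ring

/-- **THE TORUS CORNER IDENTITY, coefficientwise.** For the Fourier coefficients `c_k = 12ν k r^k` of the periodised Schochet pole
`z_P = −3ν csc²((x + iλ)/2)` (`r = e^{−λ}`), the `k`-th coefficient of `ν z_P″ + ½ z_P²` is `−ν c_k`:
`½ Σ_{i+j=k} c_i c_j − ν k² c_k = −ν c_k` — valid for every real `ν`, `r` and every `k` (pure algebra:
`72ν²r^k Σ j(k−j) = 12ν²r^k(k³ − k)`). [new here — MODEL] -/
theorem torusCorner_coeff_identity (ν r : ℝ) (k : ℕ) :
    (1 / 2) * (∑ p ∈ antidiagonal k, (12 * ν * (p.1 : ℝ) * r ^ p.1) * (12 * ν * (p.2 : ℝ) * r ^ p.2))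
      - ν * (k : ℝ) ^ 2 * (12 * ν * (k : ℝ) * r ^ k) = -ν * (12 * ν * (k : ℝ) * r ^ k) := by
  have hconv : ∑ p ∈ antidiagonal k, (12 * ν * (p.1 : ℝ) * r ^ p.1) * (12 * ν * (p.2 : ℝ) * r ^ p.2)
      = 144 * ν ^ 2 * r ^ k * ∑ j ∈ range (k + 1), (j : ℝ) * ((k : ℝ) - j) := by
    rw [Nat.sum_antidiagonal_eq_sum_range_succ
      (fun i j => (12 * ν * (i : ℝ) * r ^ i) * (12 * ν * (j : ℝ) * r ^ j)) k, mul_sum]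
    refine sum_congr rfl fun j hj => ?_
    have hjk : j ≤ k := Nat.lt_succ_iff.mp (mem_range.mp hj)
    have hpow : r ^ j * r ^ (k - j) = r ^ k := by rw [← pow_add, Nat.add_sub_cancel' hjk]
    have hcast : ((k - j : ℕ) : ℝ) = (k : ℝ) - j := by push_cast [Nat.cast_sub hjk]; ring
    rw [hcast]
    calc 12 * ν * (j : ℝ) * r ^ j * (12 * ν * ((k : ℝ) - j) * r ^ (k - j))
        = 144 * ν ^ 2 * (r ^ j * r ^ (k - j)) * ((j : ℝ) * ((k : ℝ) - j)) := by ring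
      _ = 144 * ν ^ 2 * r ^ k * ((j : ℝ) * ((k : ℝ) - j)) := by rw [hpow]
  have hsum := sum_range_mul_sub k
  rw [hconv]
  have : ∑ j ∈ range (k + 1), (j : ℝ) * ((k : ℝ) - j) = ((k : ℝ) ^ 3 - k) / 6 := by
    linarith
  rw [this]
  ring

/-- The same identity in the form «`N(c)_k = −ν c_k`» with the nonlinear-plus-viscous coefficient map written out:
for every `k`, `(½ Σ_{i+j=k} c_i c_j) + ν·(−(k²)·c_k) = −ν c_k`, `c_k = 12ν k r^k` (`ν z″` has coefficients `−νk² c_k`). [new here — MODEL] -/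
theorem torusCorner_decay_direction (ν r : ℝ) (k : ℕ) :
    (1 / 2) * (∑ p ∈ antidiagonal k, (12 * ν * (p.1 : ℝ) * r ^ p.1) * (12 * ν * (p.2 : ℝ) * r ^ p.2))
      + ν * (-((k : ℝ) ^ 2) * (12 * ν * (k : ℝ) * r ^ k)) = -ν * (12 * ν * (k : ℝ) * r ^ k) := by
  have h := torusCorner_coeff_identity ν r k
  linarith

/-- The first moment of the corner coefficient sequence converges: `Σ_k k·|−12ν k r^k| < ∞` for `0 ≤ r < 1`
(it is `12|ν| Σ k² r^k`). [folklore] -/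
theorem summable_moment_cornerCoeff (ν r : ℝ) (hr0 : 0 ≤ r) (hr1 : r < 1) :
    Summable fun k : ℕ => (k : ℝ) * |(-12 * ν * (k : ℝ) * r ^ k)| := by
  have hg : Summable fun k : ℕ => ((k : ℝ) ^ 2 : ℝ) * r ^ k :=
    summable_pow_mul_geometric_of_norm_lt_one 2 (by rwa [Real.norm_eq_abs, abs_of_nonneg hr0])
  refine (hg.mul_left (12 * |ν|)).congr fun k => ?_
  have hk : (0 : ℝ) ≤ k := Nat.cast_nonneg k
  rw [show -12 * ν * (k : ℝ) * r ^ k = (-12 * ν) * ((k : ℝ) * r ^ k) by ring, abs_mul,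
    abs_of_nonneg (mul_nonneg hk (pow_nonneg hr0 k)), show |-12 * ν| = 12 * |ν| by
      rw [abs_mul]; norm_num]
  ring

/-- **The coefficient sequences ARE those of a genuine `(ω, Hω)` pair on the torus.** For `0 ≤ r < 1` the periodic Hilbert transform
(p.v. `cot` kernel) of `ω_P = sinEval s`, `s_k = −12ν k r^k`, is `cosEval (hilbS2C s)` — the cosine series with coefficients
`12ν k r^k` (`k ≥ 1`): `Hω_P = 12ν Σ_{k≥1} k r^k cos(kx)`. [cite: Grafakos2014, Ex. 4.1.4(c); via `hilbertTransformCircle_sinEval`] -/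
theorem torusCorner_hilbert (ν r : ℝ) (hr0 : 0 ≤ r) (hr1 : r < 1) (x : ℝ) :
    hilbertTransformCircle (sinEval fun k : ℕ => -12 * ν * (k : ℝ) * r ^ k) x
      = cosEval (hilbS2C fun k : ℕ => -12 * ν * (k : ℝ) * r ^ k) x :=
  hilbertTransformCircle_sinEval (summable_moment_cornerCoeff ν r hr0 hr1) x

/-- The cosine coefficients delivered by `hilbS2C` are `12ν k r^k` for `k ≥ 1` (and `0` at `k = 0`). [new here — MODEL] -/
theorem torusCorner_hilbS2C_coeff (ν r : ℝ) (k : ℕ) (hk : k ≠ 0) :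
    hilbS2C (fun k : ℕ => -12 * ν * (k : ℝ) * r ^ k) k = 12 * ν * (k : ℝ) * r ^ k := by
  simp [hilbS2C, hk]

end SheetNSLineSchochetCornerTorus
end Summit.NavierStokesRegularity.OSWSelfSimilar
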